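/-
Copyright: statement-level skeleton of a published paper (lit-balaban cell, Phase-2 proof seat p32 gen 40). No proof claims
beyond what the kernel checks below.
-/
import Mathlib
import Literature.MathematicalPhysics.QuantumFieldTheory.Balaban1983to89.B3Sect1TwoPoint
import Literature.MathematicalPhysics.QuantumFieldTheory.Balaban1983to89.HiggsCovariancePos

/-!
# B3 — T. Bałaban, *(Higgs)₂,₃ quantum fields in a finite volume. III. Renormalization*, CMP **88** (1983) 411–445
[Balaban1983Higgs3], p. 416 [PDF 6], display **(1.21)** AS THE PRINTED INFINITE SERIES: *"The function G_ε has a perturbative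
expansion of the following structure G_ε = Σ_{n=0}^{∞} C_{ε0}[(−δm² + Σ_ε + ∂^{ε*}Σ_{ε1} + Σ*_{ε1}∂^ε + ∂^{ε*}Σ_{ε2}∂^ε)C_{ε0}]ⁿ, (1.21)
where C_{ε0} = (−Δ^ε_0 + m²)^{−1} and Σ_ε, Σ_{ε1}, Σ_{ε2} are given by amputated, one-particle-irreducible graphs of the expansion of
G_ε."*

statement-level skeleton of published theorems with citation tags; proofs where landed; nothing here is a claim about
the Yang–Mills mass gap

PDF held: `paper:balaban1983-higgs-2-3-quantum-fields-finite-volume` (journal page = PDF page + 410); p. 416 [PDF 6] read in the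
OCR text layer `p0006.txt` (display garbled there; the formula above is the row's cell of record, `HOME/lit-balaban-r15/ROWS-B3.md`
row **B3.Eq1.19-1.22**, fold owner r15, head `typed p243974`; this file = a located member for the (1.21) cell).
CONTEXT.  r15's `B3Sect1TwoPoint` (p243974) types (1.21) in an arbitrary ring of operators: the insertion
`X = selfEnergy121 δm² Σ Σ₁ Σ₁* Σ₂ ∂ ∂*`, the `n`-th term `dysonTerm C₀ X n = C₀(XC₀)ⁿ`, the RESUMMED (Dyson) form
`Eq121 G C₀ X : G = C₀ + G·X·C₀`, and proves the exact finite iteration `dyson_partial` (`G = Σ_{n<N}C₀(XC₀)ⁿ + G(XC₀)^N`) and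
`eq121_sum_of_nilpotent` (the truncated-order reading).  The printed object is the INFINITE sum `Σ_{n=0}^∞`; it is not in the tree.
THIS FILE supplies it in every normed ring of operators with summable geometric series (Mathlib `HasSummableGeomSeries`: every
complete normed ring, every normed field; in particular the finite-dimensional operator algebra `ScalarField P 0 N →L[ℝ] ScalarField
P 0 N` of the fields on `T_ε` of (1.19)/(1.20)) under the convergence hypothesis `‖X·C₀‖ < 1`:
* §1 `summable_dysonTerm`, `hasSum_dysonTerm_mul_geom`, **`eq121_tsum`** — the series (1.21) CONVERGES and its sum
  `Σ'_n C₀(XC₀)ⁿ = C₀·Σ'_n(XC₀)ⁿ` satisfies r15's resummed form `Eq121`; `tsum_dysonTerm_mul_one_sub` (`(Σ'…)(1 − XC₀) = C₀`);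
* §2 **`eq_tsum_of_eq121`** — UNIQUENESS: every solution of `Eq121 G C₀ X` IS the printed series (so r15's typed form and the
  printed display define the same `G_ε` in this regime); `hasSum_dysonTerm_of_eq121`;
* §3 **`tendsto_dyson_partial`**, `tendsto_dyson_remainder` — r15's finite iteration converges to `G` and its remainder
  `G(XC₀)^N → 0`;
* §4 **`tsum_dysonTerm_mul_inv_sub`** / `inv_sub_mul_tsum_dysonTerm` — with `C₀` invertible (`C₀ = (−Δ^ε_0 + m²)^{−1}`), the sum is
  the two-sided inverse of `C₀⁻¹ − X`, i.e. `G_ε = (−Δ^ε_0 + m² + δm² − Σ_ε − ∂^{ε*}Σ_{ε1} − Σ*_{ε1}∂^ε − ∂^{ε*}Σ_{ε2}∂^ε)^{−1}`: the mass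
  `m² + δm²` of the action (1.20) against the mass `m²` of `C_{ε0}` is what produces the insertion `−δm²` (`selfEnergy121`'s first
  letter); `norm_tsum_dysonTerm_le` (the geometric bound);
* §5 `eq121_tsum_op` / `eq_tsum_of_eq121_op` — the same on the concrete carrier: bounded operators on the scalar fields
  `HiggsLattice.ScalarField P 0 N` of `T_ε` (multiplication = composition).
* §6 (v1.1) **PRINT'S INSTANCE `C_{ε0} = (−Δ^ε_0 + m²)^{−1}` ON `T_ε`**: `freeOp msq` = the typer's `covOpK C T_ε 0 m² 0` (= `−Δ^{ε,N}_{0,T_ε}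
  + m²`, the `a_k P_k` term absent at `a = 0`: `aSeq_zero_coupling`) and `freeProp msq` = `propagatorK C T_ε 0 m² 0` read as bounded
  operators; `freeProp_mul_freeOp`/`freeOp_mul_freeProp` (`C_{ε0}(−Δ^ε_0 + m²) = 1 = (−Δ^ε_0 + m²)C_{ε0}`, `m² > 0`, from
  `HiggsCovariancePos.propagatorK_mul_covOpK`), the unit `freePropUnit`, and **`tsum_dysonTerm_freeProp_mul`** /
  **`sub_mul_tsum_dysonTerm_freeProp`**: for every insertion `X` with `‖X·C_{ε0}‖ < 1` the printed series is THE two-sided inverse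
  `(−Δ^ε_0 + m² − X)^{−1}` — with `X = −δm² + Σ_ε + …` this is `(−Δ^ε_0 + (m² + δm²) − Σ_ε − …)^{−1}`, the propagator of the action (1.20)
  (mass `m² + δm²`) dressed by the self-energy; `eq121_tsum_freeProp` (the display at print's `C_{ε0}`).
HONEST SCOPE.  (i) Print's (1.21) is a STRUCTURE STATEMENT about the formal perturbative series of `G_ε` (the Σ's are formal sums
of amputated 1PI graphs; owner r15's precision 2026-08-23T06:44:00Z); the convergent Neumann series for `‖XC₀‖ < 1` (sum =
`(C₀⁻¹ − X)⁻¹`, uniqueness, the remainder of `dyson_partial` → 0) is OUR LOCATED READING of the display, not print's claim —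
together with r15's truncated-order reading `eq121_sum_of_nilpotent` these are the two rigorous senses in the tree; the letters
`δm², Σ_ε, Σ_{ε1}, Σ*_{ε1}, Σ_{ε2}, ∂^ε, ∂^{ε*}, C_{ε0}` stay letters of an operator ring exactly as in `B3Sect1TwoPoint`.  (ii) The COMBINATORIAL half of the sentence («Σ … given by amputated 1PI graphs»
= every connected two-point graph is a chain of 1PI insertions) is not typed (no 1PI predicate in the tree; lead g11 Q15 word
2026-08-23T05:27:29Z did not require one for B3.Txt@430).  (iii) No identification of the series with the non-perturbative (1.19)
`B3Sect1TwoPoint.twoPoint` is claimed.  Theorems only, no definitions, no named facts; Mathlib + `B3Sect1TwoPoint`; standard axioms.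
Unit `lit-balaban-p32` (Phase-2 proof seat p32, gen 40), HOME `run/shared/lean/pub/lit-balaban/`, 2026-08-23.
-/

open scoped BigOperators Topology
open Filter

namespace Literature.MathematicalPhysics.QuantumFieldTheory.Balaban1983to89.B3Eq121DysonSeries

open B3Sect1TwoPoint (dysonTerm Eq121 selfEnergy121 dyson_partial)

noncomputable section

/-! ## §1 The printed series converges and satisfies the resummed form -/

section Series

variable {R : Type*} [NormedRing R] [HasSummableGeomSeries R]

omit [HasSummableGeomSeries R] in
/-- kernel: `dysonTerm C₀ X n = C₀·(XC₀)ⁿ` as a function of `n`. [cite: Balaban1983Higgs3, (1.21) p.416] -/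
theorem dysonTerm_eq_mul_pow (C0 X : R) : dysonTerm C0 X = fun n => C0 * (X * C0) ^ n := rfl

/-- **(1.21) CONVERGES**: for `‖X·C_{ε0}‖ < 1` the printed series `Σ_{n=0}^∞ C_{ε0}[XC_{ε0}]ⁿ` is summable (geometric series in a
normed ring of operators). [cite: Balaban1983Higgs3, (1.21) p.416] -/
theorem summable_dysonTerm {C0 X : R} (h : ‖X * C0‖ < 1) : Summable (dysonTerm C0 X) := by
  rw [dysonTerm_eq_mul_pow]
  exact (summable_geometric_of_norm_lt_one h).mul_left C0

/-- the sum of (1.21) is `C_{ε0}·Σ'_n(XC_{ε0})ⁿ`. [cite: Balaban1983Higgs3, (1.21) p.416] -/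
theorem tsum_dysonTerm_eq {C0 X : R} (h : ‖X * C0‖ < 1) :
    ∑' n, dysonTerm C0 X n = C0 * ∑' n, (X * C0) ^ n := by
  rw [dysonTerm_eq_mul_pow]
  exact (summable_geometric_of_norm_lt_one h).tsum_mul_left C0

/-- `HasSum` form of the previous identity. [cite: Balaban1983Higgs3, (1.21) p.416] -/
theorem hasSum_dysonTerm_mul_geom {C0 X : R} (h : ‖X * C0‖ < 1) :
    HasSum (dysonTerm C0 X) (C0 * ∑' n, (X * C0) ^ n) := by
  rw [← tsum_dysonTerm_eq h]
  exact (summable_dysonTerm h).hasSum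

/-- `(Σ'_n C_{ε0}[XC_{ε0}]ⁿ)·(1 − XC_{ε0}) = C_{ε0}` (telescoping of the geometric series). [cite: Balaban1983Higgs3, (1.21) p.416] -/
theorem tsum_dysonTerm_mul_one_sub {C0 X : R} (h : ‖X * C0‖ < 1) :
    (∑' n, dysonTerm C0 X n) * (1 - X * C0) = C0 := by
  rw [tsum_dysonTerm_eq h, mul_assoc, geom_series_mul_neg _ h, mul_one]

/-- **the sum of the printed series (1.21) satisfies the resummed (Dyson) form of record** `Eq121`:
`G = C_{ε0} + G·X·C_{ε0}` for `G := Σ_{n=0}^∞ C_{ε0}[XC_{ε0}]ⁿ`. [cite: Balaban1983Higgs3, (1.21) p.416] -/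
theorem eq121_tsum {C0 X : R} (h : ‖X * C0‖ < 1) : Eq121 (∑' n, dysonTerm C0 X n) C0 X := by
  have key := tsum_dysonTerm_mul_one_sub h
  rw [mul_sub, mul_one, sub_eq_iff_eq_add] at key
  unfold Eq121
  rw [mul_assoc]
  exact key

end Series

/-! ## §2 Uniqueness: every solution of the resummed form is the printed series -/

section Unique

variable {R : Type*} [NormedRing R] [HasSummableGeomSeries R]

omit [HasSummableGeomSeries R] in
/-- kernel: `Eq121 G C₀ X` says `G(1 − XC₀) = C₀`. [cite: Balaban1983Higgs3, (1.21) p.416] -/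
theorem mul_one_sub_eq_of_eq121 {G C0 X : R} (hG : Eq121 G C0 X) : G * (1 - X * C0) = C0 := by
  unfold Eq121 at hG
  rw [mul_sub, mul_one, ← mul_assoc, sub_eq_iff_eq_add]
  exact hG

/-- **UNIQUENESS**: for `‖X·C_{ε0}‖ < 1`, `1 − XC_{ε0}` is invertible (Mathlib `Units.oneSub`), so any `G` with
`G = C_{ε0} + G·X·C_{ε0}` equals the printed series `Σ_{n=0}^∞ C_{ε0}[XC_{ε0}]ⁿ` — r15's typed form `Eq121` and the display (1.21)
determine the same object in this regime. [cite: Balaban1983Higgs3, (1.21) p.416] -/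
theorem eq_tsum_of_eq121 {G C0 X : R} (h : ‖X * C0‖ < 1) (hG : Eq121 G C0 X) :
    G = ∑' n, dysonTerm C0 X n := by
  have h1 := mul_one_sub_eq_of_eq121 hG
  have hu : (1 - X * C0) * ∑' n : ℕ, (X * C0) ^ n = 1 := mul_neg_geom_series _ h
  have eG : G = C0 * ∑' n : ℕ, (X * C0) ^ n :=
    calc G = G * ((1 - X * C0) * ∑' n : ℕ, (X * C0) ^ n) := by rw [hu, mul_one]
      _ = C0 * ∑' n : ℕ, (X * C0) ^ n := by rw [← mul_assoc, h1]
  rw [eG, tsum_dysonTerm_eq h]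

/-- the solutions of `Eq121` are exactly one: the series. [cite: Balaban1983Higgs3, (1.21) p.416] -/
theorem eq121_iff_eq_tsum {G C0 X : R} (h : ‖X * C0‖ < 1) :
    Eq121 G C0 X ↔ G = ∑' n, dysonTerm C0 X n :=
  ⟨eq_tsum_of_eq121 h, fun hG => hG ▸ eq121_tsum h⟩

/-- `HasSum` form: under `Eq121` and `‖XC_{ε0}‖ < 1` the printed series sums to `G`. [cite: Balaban1983Higgs3, (1.21) p.416] -/
theorem hasSum_dysonTerm_of_eq121 {G C0 X : R} (h : ‖X * C0‖ < 1) (hG : Eq121 G C0 X) :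
    HasSum (dysonTerm C0 X) G := by
  rw [eq_tsum_of_eq121 h hG]
  exact (summable_dysonTerm h).hasSum

end Unique

/-! ## §3 The finite iteration of record converges; its remainder tends to zero -/

section Limits

variable {R : Type*} [NormedRing R] [HasSummableGeomSeries R]

/-- **the partial sums of (1.21) converge to `G`**: `Σ_{n<N} C_{ε0}[XC_{ε0}]ⁿ → G` (`N → ∞`) for every solution of `Eq121` with
`‖XC_{ε0}‖ < 1` — the limit form of r15's `dyson_partial`. [cite: Balaban1983Higgs3, (1.21) p.416] -/
theorem tendsto_dyson_partial {G C0 X : R} (h : ‖X * C0‖ < 1) (hG : Eq121 G C0 X) :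
    Tendsto (fun N => ∑ n ∈ Finset.range N, dysonTerm C0 X n) atTop (𝓝 G) :=
  (hasSum_dysonTerm_of_eq121 h hG).tendsto_sum_nat

/-- the remainder of r15's exact finite expansion `G = Σ_{n<N} C_{ε0}[XC_{ε0}]ⁿ + G(XC_{ε0})^N` tends to `0`.
[cite: Balaban1983Higgs3, (1.21) p.416] -/
theorem tendsto_dyson_remainder {R : Type*} [NormedRing R] (G : R) {C0 X : R} (h : ‖X * C0‖ < 1) :
    Tendsto (fun N => G * (X * C0) ^ N) atTop (𝓝 0) := by
  have h0 := (tendsto_pow_atTop_nhds_zero_of_norm_lt_one h).const_mul G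
  rwa [mul_zero] at h0

/-- consistency: the partial sum IS `G` minus the remainder (r15's `dyson_partial`, restated). [cite: Balaban1983Higgs3, (1.21) p.416] -/
theorem dyson_partial_sub {R : Type*} [Ring R] {G C0 X : R} (hG : Eq121 G C0 X) (N : ℕ) :
    ∑ n ∈ Finset.range N, dysonTerm C0 X n = G - G * (X * C0) ^ N := by
  rw [eq_sub_iff_add_eq]
  exact (dyson_partial hG N).symm

end Limits

/-! ## §4 The sum as the inverse of `C_{ε0}⁻¹ − X`; the geometric bound -/

section Inverse

variable {R : Type*} [NormedRing R] [HasSummableGeomSeries R]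

/-- **`Σ_{n=0}^∞ C_{ε0}[XC_{ε0}]ⁿ = (C_{ε0}^{−1} − X)^{−1}`, right inverse**: with `C_{ε0}` invertible (`C_{ε0} = (−Δ^ε_0 + m²)^{−1}`,
so `C_{ε0}^{−1} − X = −Δ^ε_0 + m² + δm² − Σ_ε − ∂^{ε*}Σ_{ε1} − Σ*_{ε1}∂^ε − ∂^{ε*}Σ_{ε2}∂^ε` for `X = selfEnergy121 …`),
`(Σ'…)·(C_{ε0}^{−1} − X) = 1`. [cite: Balaban1983Higgs3, (1.21) p.416] -/
theorem tsum_dysonTerm_mul_inv_sub (C0 : Rˣ) {X : R} (h : ‖X * C0‖ < 1) :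
    (∑' n, dysonTerm (C0 : R) X n) * (↑C0⁻¹ - X) = 1 := by
  have e : (↑C0⁻¹ - X : R) = (1 - X * C0) * ↑C0⁻¹ := by
    rw [sub_mul, one_mul, mul_assoc, Units.mul_inv, mul_one]
  rw [e, ← mul_assoc, tsum_dysonTerm_mul_one_sub h, Units.mul_inv]

/-- **left inverse**: `(C_{ε0}^{−1} − X)·(Σ'…) = 1`. [cite: Balaban1983Higgs3, (1.21) p.416] -/
theorem inv_sub_mul_tsum_dysonTerm (C0 : Rˣ) {X : R} (h : ‖X * C0‖ < 1) :
    (↑C0⁻¹ - X) * ∑' n, dysonTerm (C0 : R) X n = 1 := by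
  have e : (↑C0⁻¹ - X : R) = ↑C0⁻¹ * (1 - C0 * X) := by
    rw [mul_sub, mul_one, ← mul_assoc, Units.inv_mul, one_mul]
  -- `Σ' C₀(XC₀)ⁿ = Σ' (C₀X)ⁿC₀`: both are `C₀Σ'(XC₀)ⁿ`; use `(1 − C₀X)C₀ = C₀(1 − XC₀)` and the two-sided unit `1 − XC₀`
  have hXC : ‖X * C0‖ < 1 := h
  have hcomm : (1 - (C0 : R) * X) * C0 = C0 * (1 - X * C0) := by
    rw [sub_mul, one_mul, mul_sub, mul_one, mul_assoc]
  have hu : (1 - X * (C0 : R)) * ∑' n : ℕ, (X * C0) ^ n = 1 := mul_neg_geom_series _ hXC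
  rw [e, tsum_dysonTerm_eq h, mul_assoc, ← mul_assoc (1 - (C0 : R) * X), hcomm, mul_assoc, hu, mul_one, Units.inv_mul]

/-- hence the sum is a UNIT of the operator ring with inverse `C_{ε0}^{−1} − X`. [cite: Balaban1983Higgs3, (1.21) p.416] -/
theorem isUnit_tsum_dysonTerm (C0 : Rˣ) {X : R} (h : ‖X * C0‖ < 1) : IsUnit (∑' n, dysonTerm (C0 : R) X n) :=
  ⟨⟨_, _, tsum_dysonTerm_mul_inv_sub C0 h, inv_sub_mul_tsum_dysonTerm C0 h⟩, rfl⟩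

/-- and `C_{ε0}^{−1} − X` is a unit with inverse the printed series. [cite: Balaban1983Higgs3, (1.21) p.416] -/
theorem isUnit_inv_sub (C0 : Rˣ) {X : R} (h : ‖X * C0‖ < 1) : IsUnit (↑C0⁻¹ - X : R) :=
  ⟨⟨_, _, inv_sub_mul_tsum_dysonTerm C0 h, tsum_dysonTerm_mul_inv_sub C0 h⟩, rfl⟩

omit [HasSummableGeomSeries R] in
/-- any `G` inverting `C_{ε0}^{−1} − X` on the right satisfies `Eq121`, hence is the series. [cite: Balaban1983Higgs3, (1.21) p.416] -/
theorem eq121_of_mul_inv_sub_eq_one (C0 : Rˣ) {G X : R} (hG : G * (↑C0⁻¹ - X) = 1) : Eq121 G (C0 : R) X := by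
  unfold Eq121
  have h1 : G * ↑C0⁻¹ = 1 + G * X := by
    rw [mul_sub, sub_eq_iff_eq_add] at hG
    exact hG
  calc G = G * ↑C0⁻¹ * (C0 : R) := by rw [mul_assoc, Units.inv_mul, mul_one]
    _ = (1 + G * X) * C0 := by rw [h1]
    _ = C0 + G * X * C0 := by rw [add_mul, one_mul]

/-- **geometric bound**: `‖Σ_{n=0}^∞ C_{ε0}[XC_{ε0}]ⁿ‖ ≤ ‖C_{ε0}‖·(‖1‖ − 1 + (1 − ‖XC_{ε0}‖)^{−1})` (Mathlib's bound, valid without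
`‖1‖ = 1`). [cite: Balaban1983Higgs3, (1.21) p.416] -/
theorem norm_tsum_dysonTerm_le {C0 X : R} (h : ‖X * C0‖ < 1) :
    ‖∑' n, dysonTerm C0 X n‖ ≤ ‖C0‖ * (‖(1 : R)‖ - 1 + (1 - ‖X * C0‖)⁻¹) := by
  rw [tsum_dysonTerm_eq h]
  exact (norm_mul_le _ _).trans (mul_le_mul_of_nonneg_left (tsum_geometric_le_of_norm_lt_one _ h) (norm_nonneg _))

omit [HasSummableGeomSeries R] in
/-- a sufficient condition for the hypothesis: `‖X‖·‖C_{ε0}‖ < 1`. [cite: Balaban1983Higgs3, (1.21) p.416] -/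
theorem norm_mul_lt_one_of {C0 X : R} (h : ‖X‖ * ‖C0‖ < 1) : ‖X * C0‖ < 1 :=
  (norm_mul_le _ _).trans_lt h

end Inverse

/-! ## §5 The concrete carrier: bounded operators on the scalar fields of `T_ε` -/

section Operators

open HiggsLattice

variable {P : Params} {N : ℕ}

/-- **(1.21) on the operators of the fields on `T_ε`**: for bounded operators `C_{ε0}`, `X` on `ScalarField P 0 N = T_ε → ℝ^N`
(composition ring, complete — finite-dimensional), `‖X ∘ C_{ε0}‖ < 1` ⇒ the series `Σ_{n=0}^∞ C_{ε0}[XC_{ε0}]ⁿ` converges and its sum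
satisfies `Eq121`. [cite: Balaban1983Higgs3, (1.21) p.416] -/
theorem eq121_tsum_op {C0 X : ScalarField P 0 N →L[ℝ] ScalarField P 0 N} (h : ‖X * C0‖ < 1) :
    Eq121 (∑' n, dysonTerm C0 X n) C0 X :=
  eq121_tsum h

/-- and every operator solution of `Eq121` is that series. [cite: Balaban1983Higgs3, (1.21) p.416] -/
theorem eq_tsum_of_eq121_op {G C0 X : ScalarField P 0 N →L[ℝ] ScalarField P 0 N} (h : ‖X * C0‖ < 1) (hG : Eq121 G C0 X) :
    G = ∑' n, dysonTerm C0 X n :=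
  eq_tsum_of_eq121 h hG

/-- applied to a field: `G φ = Σ_{n=0}^∞ C_{ε0}[XC_{ε0}]ⁿ φ` (evaluation is continuous, so the operator series may be summed
pointwise). [cite: Balaban1983Higgs3, (1.21) p.416] -/
theorem hasSum_dysonTerm_apply {G C0 X : ScalarField P 0 N →L[ℝ] ScalarField P 0 N} (h : ‖X * C0‖ < 1) (hG : Eq121 G C0 X)
    (φ : ScalarField P 0 N) : HasSum (fun n => dysonTerm C0 X n φ) (G φ) :=
  ((hasSum_dysonTerm_of_eq121 h hG).map (ContinuousLinearMap.apply ℝ (ScalarField P 0 N) φ)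
    (ContinuousLinearMap.apply ℝ (ScalarField P 0 N) φ).continuous :)

/-- with the printed insertion `X = −δm² + Σ_ε + ∂^{ε*}Σ_{ε1} + Σ*_{ε1}∂^ε + ∂^{ε*}Σ_{ε2}∂^ε` (r15's `selfEnergy121`, letters =
operators on the fields of `T_ε`): the same statement, displayed. [cite: Balaban1983Higgs3, (1.21) p.416] -/
theorem eq121_tsum_selfEnergy {C0 dm2 Sg Sg1 Sg1s Sg2 d ds : ScalarField P 0 N →L[ℝ] ScalarField P 0 N}
    (h : ‖selfEnergy121 dm2 Sg Sg1 Sg1s Sg2 d ds * C0‖ < 1) :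
    Eq121 (∑' n, dysonTerm C0 (selfEnergy121 dm2 Sg Sg1 Sg1s Sg2 d ds) n) C0 (selfEnergy121 dm2 Sg Sg1 Sg1s Sg2 d ds) :=
  eq121_tsum h

end Operators

/-! ## §6 (v1.1) Print's instance: `C_{ε0} = (−Δ^ε_0 + m²)^{−1}` on the fields of `T_ε` -/

section FreeResolvent

open HiggsLattice HiggsCovariance HiggsCovariancePos

variable {P : Params} {N : ℕ} (C : ChargeData N)

/-- kernel: at `a = 0` the sequence `a_k` of (I.2.15) vanishes, so `covOpK C Ω A m² 0 k = −Δ^{ε,N}_{A,Ω} + m²` has no `P_k` term.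
[cite: Balaban1982Higgs1, (2.15) p.609] -/
theorem aSeq_zero_coupling (L : ℝ) (k : ℕ) : B1.aSeq 0 L k = 0 := by
  simp [B1.aSeq]

/-- **`C_{ε0}^{−1} = −Δ^ε_0 + m²`** on `ScalarField P 0 N = (T_ε → ℝ^N)`: the typer's `covOpK` at zero background, whole torus, `a = 0`
(`−Δ^{ε,N}_{0,T_ε} + m² + 0·P_k`), read as a bounded operator. [cite: Balaban1983Higgs3, (1.21) p.416] -/
def freeOp (msq : ℝ) : ScalarField P 0 N →L[ℝ] ScalarField P 0 N :=
  LinearMap.toContinuousLinearMap (covOpK C Finset.univ (0 : VecField P 0) msq 0 0)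

/-- **`C_{ε0} = (−Δ^ε_0 + m²)^{−1}`** (p. 416: *"where C_{ε0} = (−Δ^ε_0 + m²)^{−1}"*): the typer's `propagatorK` at zero background, whole
torus, `a = 0`, read as a bounded operator. [cite: Balaban1983Higgs3, (1.21) p.416] -/
def freeProp (msq : ℝ) : ScalarField P 0 N →L[ℝ] ScalarField P 0 N :=
  LinearMap.toContinuousLinearMap (propagatorK C Finset.univ (0 : VecField P 0) msq 0 0)

/-- `freeOp` acts as `covOpK`. [cite: Balaban1983Higgs3, (1.21) p.416] -/
theorem freeOp_apply (msq : ℝ) (φ : ScalarField P 0 N) :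
    freeOp C msq φ = covOpK C Finset.univ (0 : VecField P 0) msq 0 0 φ := rfl

/-- `freeProp` acts as `propagatorK`. [cite: Balaban1983Higgs3, (1.21) p.416] -/
theorem freeProp_apply (msq : ℝ) (φ : ScalarField P 0 N) :
    freeProp C msq φ = propagatorK C Finset.univ (0 : VecField P 0) msq 0 0 φ := rfl

/-- `C_{ε0}(−Δ^ε_0 + m²) = 1` for `m² > 0` (`HiggsCovariancePos.propagatorK_covOpK_apply`). [cite: Balaban1983Higgs3, (1.21) p.416] -/
theorem freeProp_mul_freeOp {msq : ℝ} (hmsq : 0 < msq) : freeProp C msq * freeOp C msq = (1 : ScalarField P 0 N →L[ℝ] _) := by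
  ext φ : 1
  change freeProp C msq (freeOp C msq φ) = φ
  rw [freeOp_apply, freeProp_apply]
  exact propagatorK_covOpK_apply C Finset.univ 0 hmsq 0 0 (by rw [aSeq_zero_coupling]) φ

/-- `(−Δ^ε_0 + m²)C_{ε0} = 1` for `m² > 0`. [cite: Balaban1983Higgs3, (1.21) p.416] -/
theorem freeOp_mul_freeProp {msq : ℝ} (hmsq : 0 < msq) : freeOp C msq * freeProp C msq = (1 : ScalarField P 0 N →L[ℝ] _) := by
  ext φ : 1
  change freeOp C msq (freeProp C msq φ) = φ
  rw [freeOp_apply, freeProp_apply]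
  exact covOpK_propagatorK_apply C Finset.univ 0 hmsq 0 0 (by rw [aSeq_zero_coupling]) φ

/-- `C_{ε0}` as a unit of the operator ring, with inverse `−Δ^ε_0 + m²`. [cite: Balaban1983Higgs3, (1.21) p.416] -/
def freePropUnit {msq : ℝ} (hmsq : 0 < msq) : (ScalarField P 0 N →L[ℝ] ScalarField P 0 N)ˣ :=
  ⟨freeProp C msq, freeOp C msq, freeProp_mul_freeOp C hmsq, freeOp_mul_freeProp C hmsq⟩

/-- the unit is `C_{ε0}`. [cite: Balaban1983Higgs3, (1.21) p.416] -/
theorem val_freePropUnit {msq : ℝ} (hmsq : 0 < msq) : (freePropUnit C (P := P) hmsq).val = freeProp C msq := rfl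

/-- its inverse is `−Δ^ε_0 + m²`. [cite: Balaban1983Higgs3, (1.21) p.416] -/
theorem val_inv_freePropUnit {msq : ℝ} (hmsq : 0 < msq) :
    ((freePropUnit C hmsq)⁻¹ : (ScalarField P 0 N →L[ℝ] ScalarField P 0 N)ˣ).val = freeOp C msq := rfl

/-- **(1.21) at print's `C_{ε0}`**: for every insertion `X` on the fields of `T_ε` with `‖X·C_{ε0}‖ < 1`, the printed series
`Σ_{n=0}^∞ C_{ε0}[XC_{ε0}]ⁿ` converges and satisfies the resummed form `Eq121` (`m² > 0` not even needed here).
[cite: Balaban1983Higgs3, (1.21) p.416] -/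
theorem eq121_tsum_freeProp (msq : ℝ) {X : ScalarField P 0 N →L[ℝ] ScalarField P 0 N} (h : ‖X * freeProp C msq‖ < 1) :
    Eq121 (∑' n, dysonTerm (freeProp C msq) X n) (freeProp C msq) X :=
  eq121_tsum h

/-- **`Σ_{n=0}^∞ C_{ε0}[XC_{ε0}]ⁿ · (−Δ^ε_0 + m² − X) = 1`**: at print's `C_{ε0}` the series is a right inverse of the dressed operator
— with `X = −δm² + Σ_ε + ∂^{ε*}Σ_{ε1} + Σ*_{ε1}∂^ε + ∂^{ε*}Σ_{ε2}∂^ε`, of `−Δ^ε_0 + (m² + δm²) − Σ_ε − …` (the action (1.20) carries the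
mass `m² + δm²`). [cite: Balaban1983Higgs3, (1.21) p.416] -/
theorem tsum_dysonTerm_freeProp_mul {msq : ℝ} (hmsq : 0 < msq) {X : ScalarField P 0 N →L[ℝ] ScalarField P 0 N}
    (h : ‖X * freeProp C msq‖ < 1) :
    (∑' n, dysonTerm (freeProp C msq) X n) * (freeOp C msq - X) = 1 := by
  have := tsum_dysonTerm_mul_inv_sub (freePropUnit C hmsq) (X := X) h
  rwa [val_inv_freePropUnit] at this

/-- **`(−Δ^ε_0 + m² − X) · Σ_{n=0}^∞ C_{ε0}[XC_{ε0}]ⁿ = 1`**: and a left inverse — the series IS `(−Δ^ε_0 + m² − X)^{−1}`.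
[cite: Balaban1983Higgs3, (1.21) p.416] -/
theorem sub_mul_tsum_dysonTerm_freeProp {msq : ℝ} (hmsq : 0 < msq) {X : ScalarField P 0 N →L[ℝ] ScalarField P 0 N}
    (h : ‖X * freeProp C msq‖ < 1) :
    (freeOp C msq - X) * (∑' n, dysonTerm (freeProp C msq) X n) = 1 := by
  have := inv_sub_mul_tsum_dysonTerm (freePropUnit C hmsq) (X := X) h
  rwa [val_inv_freePropUnit] at this

/-- hence `−Δ^ε_0 + m² − X` is invertible on the fields of `T_ε` whenever `‖XC_{ε0}‖ < 1`, with inverse the printed series.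
[cite: Balaban1983Higgs3, (1.21) p.416] -/
theorem isUnit_freeOp_sub {msq : ℝ} (hmsq : 0 < msq) {X : ScalarField P 0 N →L[ℝ] ScalarField P 0 N}
    (h : ‖X * freeProp C msq‖ < 1) : IsUnit (freeOp C msq - X) :=
  ⟨⟨_, _, sub_mul_tsum_dysonTerm_freeProp C hmsq h, tsum_dysonTerm_freeProp_mul C hmsq h⟩, rfl⟩

/-- and any operator `G` with `G(−Δ^ε_0 + m² − X) = 1` is that series (uniqueness at print's instance).
[cite: Balaban1983Higgs3, (1.21) p.416] -/
theorem eq_tsum_of_mul_freeOp_sub_eq_one {msq : ℝ} (hmsq : 0 < msq) {G X : ScalarField P 0 N →L[ℝ] ScalarField P 0 N}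
    (h : ‖X * freeProp C msq‖ < 1) (hG : G * (freeOp C msq - X) = 1) : G = ∑' n, dysonTerm (freeProp C msq) X n := by
  have hG' : Eq121 G (freeProp C msq) X := by
    have := eq121_of_mul_inv_sub_eq_one (freePropUnit C hmsq) (G := G) (X := X)
    rw [val_inv_freePropUnit, val_freePropUnit] at this
    exact this hG
  exact eq_tsum_of_eq121 h hG'

end FreeResolvent

end

end Literature.MathematicalPhysics.QuantumFieldTheory.Balaban1983to89.B3Eq121DysonSeries
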